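import Literature.Computability.AlgebraicComplexity.Hyperdeterminant
import Literature.Computability.AlgebraicComplexity.HamiltonianCycleVNP
import Literature.Computability.AlgebraicComplexity.DetInVP
import Literature.Computability.AlgebraicComplexity.ValiantClassesProofs
import Literature.Computability.AlgebraicComplexity.ArithCircuitProofs

/-!
# Crux `DetQP.DetqpThesis` (stmt-ValiantsHypothesis-0315), line `Sketch` — stub
# `stub_isVNPFamily_hyperdet` (S2): the four-dimensional hyperdeterminant family is in `VNP`

`HD_n := hyperdet (fun I : Fin 4 → Fin n => X I)` (Cayley's first hyperdeterminant of the generic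
`n × n × n × n` array, `Hyperdeterminant.lean`) is
`∑_{σ₀,σ₁,σ₂,σ₃ ∈ 𝔖_n} (∏_j sgn σ_j) ∏_i x_{σ₀ i, σ₁ i, σ₂ i, σ₃ i}`.  We prove
`IsVNPFamily (HD_n)_n` over `ℂ` literally in the format of Bürgisser 2000, Def. 2.5
(= `IsVNPFamily`): `HD` is a p-family (`n⁴` variables, degree `≤ n`; `isPFamily_hyperdet`) and
`HD_n = ∑_{e ∈ {0,1}^{4n²}} G_n(X, e)` for a `VP` family `G_n` (`exists_witness`).

The witness (BCS 1997, Prop. (21.15) technique, as in `HamiltonianCycleVNP.lean`; no new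
definitions, the witness is written out): the Boolean block consists of FOUR `n × n` position
matrices `Z⁰, …, Z³` (variable `Sum.inr (e (j, (t, i)))`, `e : Fin 4 × (Fin n × Fin n) ≃ Fin (4n²)`,
is `Zʲ_{t i} = [σ_j t = i]`), and

  `G_n = (∏_j α(Zʲ) β(Zʲ)) · ((∏_j det Zʲ) · ∏_i ∑_{a : Fin 4 → Fin n} (∏_j Zʲ_{i, a j}) x_a)`,

where `α β` is BCS's permutation-matrix recogniser (`conflictPairs`, `recogniser_permGraph`,
`recogniser_eq_zero`; iterated over the four matrices: `sum_prod_recogniser_mul`), `det Zʲ` (the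
generic determinant `detPoly` renamed to `Zʲ`; in `VP` by `complexity_detPoly_le`, Berkowitz)
evaluates at the permutation matrix of `σ_j` to `sgn σ_j` (`Matrix.det_permutation`), and the last
factor evaluates to the monomial `∏_i x_{σ₀ i, …, σ₃ i}` (`cover_permGraph`).  Summing over
`{0,1}^{4n²}` leaves the sum over `𝔖_n⁴`, i.e. `HD_n` (`boolSum_witness`).  Size: `n⁴ + 4n²`
variables, degree `≤ 21 (n+1)⁴`, complexity `≤ 83 (n+1)⁷`.

References: P. Bürgisser, M. Clausen, M. A. Shokrollahi, *Algebraic Complexity Theory*,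
Springer 1997, Prop. (21.15); P. Bürgisser, *Completeness and Reduction in Algebraic Complexity
Theory*, Springer 2000, Def. 2.3–2.5.
-/

noncomputable section

-- single-conjunct layout: Sub = Summit, duplicated namespace component intended
set_option linter.dupNamespace false

namespace Summit.ValiantsHypothesis.ValiantsHypothesis.Theorems.DetQPDetqpThesis

open Literature.Computability.AlgebraicComplexity MvPolynomial Equiv

universe u

namespace HyperdetVNP

/-! ### Boolean sums against several recognisers -/

section Recogniser

variable {N : ℕ}

/-- **Iterated recogniser** (BCS 1997, Prop. (21.15), (A), (B), (D), applied slot by slot): for a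
family of Boolean `N × N` matrices `E j` and any weight `G`,
`∑_E (∏_j α(E j) β(E j)) G(E) = ∑_{σ : ι → 𝔖_N} G(j ↦ P_{σ j})`.
[cite: BurgisserClausenShokrollahi1997, Prop. (21.15)] -/
theorem sum_prod_recogniser_mul {R : Type*} [CommRing R] {ι : Type*} [Fintype ι] [DecidableEq ι]
    (G : (ι → (Fin N × Fin N → Bool)) → R) :
    ∑ E : ι → (Fin N × Fin N → Bool),
      (∏ j, ((∏ pq ∈ conflictPairs N, (1 - (if E j pq.1 then (1 : R) else 0) *
          (if E j pq.2 then (1 : R) else 0))) *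
        (∏ t, ∑ i, (if E j (t, i) then (1 : R) else 0)))) * G E =
      ∑ σ : ι → Perm (Fin N), G (fun j => permGraph (σ j)) := by
  classical
  have h : ∀ E : ι → (Fin N × Fin N → Bool),
      (∏ j, ((∏ pq ∈ conflictPairs N, (1 - (if E j pq.1 then (1 : R) else 0) *
          (if E j pq.2 then (1 : R) else 0))) *
        (∏ t, ∑ i, (if E j (t, i) then (1 : R) else 0)))) * G E =
      if ∃ σ : ι → Perm (Fin N), (fun j => permGraph (σ j)) = E then G E else 0 := by
    intro E
    split_ifs with hσ
    · obtain ⟨σ, rfl⟩ := hσ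
      simp only [recogniser_permGraph, Finset.prod_const_one, one_mul]
    · obtain ⟨j, hj⟩ : ∃ j, ∀ τ : Perm (Fin N), permGraph τ ≠ E j := by
        by_contra hall
        push Not at hall
        choose σ hσ' using hall
        exact hσ ⟨σ, funext hσ'⟩
      rw [Finset.prod_eq_zero (Finset.mem_univ j) (recogniser_eq_zero hj), zero_mul]
  rw [Finset.sum_congr rfl fun E _ => h E, ← Finset.sum_filter]
  have hfi : (Finset.univ.filter fun E : ι → (Fin N × Fin N → Bool) =>
      ∃ σ : ι → Perm (Fin N), (fun j => permGraph (σ j)) = E) =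
      Finset.univ.image (fun σ : ι → Perm (Fin N) => fun j => permGraph (σ j)) := by
    ext E
    simp
  rw [hfi, Finset.sum_image fun σ _ σ' _ h =>
    funext fun j => permGraph_injective (congrFun h j)]

/-- The `0/1` matrix of the permutation matrix `P_σ` (entry `[σ t = i]`) has determinant `sgn σ`
(`Matrix.det_permutation`). [folklore] -/
theorem det_of_permGraph {R : Type*} [CommRing R] (σ : Perm (Fin N)) :
    (Matrix.of fun t i => if permGraph σ (t, i) then (1 : R) else 0).det =
      (Equiv.Perm.sign σ : R) := by
  rw [← Matrix.det_permutation]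
  congr 1
  ext t i
  simp [permGraph, eq_comm]

end Recogniser

/-! ### The witness and its Boolean sum -/

section Witness

variable (n : ℕ) (k : Type u) [CommRing k] {m : ℕ}

/-- Substituting into a renamed generic determinant gives the determinant of the substituted
matrix (`AlgHom.map_det`). [folklore] -/
theorem aeval_rename_detPoly {τ : Type*} {S : Type*} [CommRing S] [Algebra k S]
    (v : Fin n × Fin n → τ) (f : τ → S) :
    aeval f (rename v (detPoly (Fin n) k)) = (Matrix.of fun t i => f (v (t, i))).det := by
  rw [aeval_rename, detPoly, AlgHom.map_det]
  congr 1
  ext t i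
  simp

/-- At the position matrices of `σ` the cover product is the monomial
`∏_i x_{σ₀ i, σ₁ i, σ₂ i, σ₃ i}`. [folklore] -/
theorem cover_permGraph (σ : Fin 4 → Perm (Fin n)) :
    (∏ i : Fin n, ∑ a : Fin 4 → Fin n,
      (∏ j : Fin 4,
          (if permGraph (σ j) (i, a j) then (1 : MvPolynomial (Fin 4 → Fin n) k) else 0)) *
        X a) = ∏ i : Fin n, X (fun j => σ j i) := by
  refine Finset.prod_congr rfl fun i _ => ?_
  rw [Finset.sum_eq_single (fun j => σ j i)]
  · simp [permGraph]
  · intro a _ ha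
    obtain ⟨j, hj⟩ : ∃ j, a j ≠ σ j i := by
      by_contra h
      push Not at h
      exact ha (funext h)
    rw [Finset.prod_eq_zero (Finset.mem_univ j) (by simp [permGraph, Ne.symm hj]), zero_mul]
  · exact fun h => absurd (Finset.mem_univ _) h

/-- `boolSum` over the Boolean block `Fin m ≃ Fin 4 × (Fin n × Fin n)` as a sum over four Boolean
`n × n` matrices `E`, position variable `q` being set to `[E (e⁻¹ q)]`. [folklore] -/
theorem boolSum_eq_sum_matrices (e : Fin 4 × (Fin n × Fin n) ≃ Fin m)
    (g : MvPolynomial ((Fin 4 → Fin n) ⊕ Fin m) k) :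
    boolSum g = ∑ E : Fin 4 → (Fin n × Fin n → Bool),
      aeval (Sum.elim X fun q => if E (e.symm q).1 (e.symm q).2 then
        (1 : MvPolynomial (Fin 4 → Fin n) k) else 0) g := by
  unfold boolSum
  refine Fintype.sum_equiv (⟨fun x j p => x (e (j, p)), fun E q => E (e.symm q).1 (e.symm q).2,
    fun x => _root_.funext fun q => by simp,
    fun E => _root_.funext fun j => _root_.funext fun p => by simp⟩ :
      (Fin m → Bool) ≃ (Fin 4 → (Fin n × Fin n → Bool))) _ _ fun x => ?_
  simp only [Equiv.coe_fn_mk, Prod.mk.eta, Equiv.apply_symm_apply]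

/-- **`HD_n` is the Boolean sum of the witness** `G_n` (written out; `e` enumerates the Boolean
positions): `∑_{x ∈ {0,1}^{m}} G_n(X, x) = ∑_{σ ∈ 𝔖_n⁴} (∏_j sgn σ_j) ∏_i x_{σ₀ i, …, σ₃ i} = HD_n`
(BCS 1997, Prop. (21.15): (A)–(D) for the recogniser, slot by slot). [folklore] -/
theorem boolSum_witness (e : Fin 4 × (Fin n × Fin n) ≃ Fin m) :
    boolSum ((∏ j : Fin 4, ((∏ pq ∈ conflictPairs n,
              (1 - X (Sum.inr (e (j, pq.1))) * X (Sum.inr (e (j, pq.2))))) *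
            ∏ t : Fin n, ∑ i : Fin n, X (Sum.inr (e (j, (t, i)))))) *
          ((∏ j : Fin 4, rename (fun p => Sum.inr (e (j, p))) (detPoly (Fin n) k)) *
            ∏ i : Fin n, ∑ a : Fin 4 → Fin n,
              (∏ j : Fin 4, X (Sum.inr (e (j, (i, a j))))) * X (Sum.inl a)) :
        MvPolynomial ((Fin 4 → Fin n) ⊕ Fin m) k) =
      hyperdet (fun I : Fin 4 → Fin n => (X I : MvPolynomial (Fin 4 → Fin n) k)) := by
  rw [boolSum_eq_sum_matrices n k e]
  simp only [map_mul, map_prod, map_sum, map_sub, map_one, aeval_X, Sum.elim_inl, Sum.elim_inr,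
    aeval_rename_detPoly, Equiv.symm_apply_apply]
  refine (sum_prod_recogniser_mul _).trans ?_
  unfold hyperdet
  dsimp only
  refine Finset.sum_congr rfl fun σ _ => ?_
  rw [cover_permGraph]
  simp only [det_of_permGraph]

end Witness

/-! ### Size of the witness -/

section Bounds

variable (n : ℕ) (k : Type u) [CommRing k] {m : ℕ} (e : Fin 4 × (Fin n × Fin n) ≃ Fin m)

/-- `n ^ a ≤ (n + 1) ^ b` for `a ≤ b`. [folklore] -/
theorem pow_le_succ_pow {a b : ℕ} (h : a ≤ b) : n ^ a ≤ (n + 1) ^ b :=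
  (Nat.pow_le_pow_left (Nat.le_succ n) a).trans (Nat.pow_le_pow_right n.succ_pos h)

/-- `deg α(Zʲ) ≤ 2 n⁴` (at most `n⁴` factors of degree `2`). [folklore] -/
theorem totalDegree_alpha_le (j : Fin 4) :
    (∏ pq ∈ conflictPairs n, (1 - X (Sum.inr (e (j, pq.1))) * X (Sum.inr (e (j, pq.2)))) :
      MvPolynomial ((Fin 4 → Fin n) ⊕ Fin m) k).totalDegree ≤ n ^ 4 * 2 :=
  (totalDegree_prod_le_of_le _ _ _ fun _ _ => totalDegree_one_sub_X_mul_X_le _ _).trans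
    (Nat.mul_le_mul_right 2 (card_conflictPairs_le _))

/-- `deg β(Zʲ) ≤ n`. [folklore] -/
theorem totalDegree_beta_le (j : Fin 4) :
    (∏ t : Fin n, ∑ i : Fin n, X (Sum.inr (e (j, (t, i)))) :
      MvPolynomial ((Fin 4 → Fin n) ⊕ Fin m) k).totalDegree ≤ n * 1 :=
  (totalDegree_prod_le_of_le _ _ _ fun _ _ =>
    totalDegree_sum_le_of_le _ _ _ fun _ _ => totalDegree_X_le_one _).trans (by simp)

/-- `deg det Zʲ ≤ n`. [folklore] -/
theorem totalDegree_sign_le (j : Fin 4) :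
    (rename (fun p => Sum.inr (e (j, p))) (detPoly (Fin n) k) :
      MvPolynomial ((Fin 4 → Fin n) ⊕ Fin m) k).totalDegree ≤ n :=
  (totalDegree_rename_le _ _).trans
    (detPoly_isHomogeneous.totalDegree_le.trans (Fintype.card_fin n).le)

/-- `deg cover ≤ 5 n`. [folklore] -/
theorem totalDegree_cover_le :
    (∏ i : Fin n, ∑ a : Fin 4 → Fin n,
        (∏ j : Fin 4, X (Sum.inr (e (j, (i, a j))))) * X (Sum.inl a) :
      MvPolynomial ((Fin 4 → Fin n) ⊕ Fin m) k).totalDegree ≤ n * 5 := by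
  refine (totalDegree_prod_le_of_le _ _ 5 fun i _ =>
    totalDegree_sum_le_of_le _ _ 5 fun a _ => ?_).trans (by simp)
  have h1 := totalDegree_prod_le_of_le (Finset.univ : Finset (Fin 4))
    (fun j => (X (Sum.inr (e (j, (i, a j)))) : MvPolynomial ((Fin 4 → Fin n) ⊕ Fin m) k)) 1
    fun _ _ => totalDegree_X_le_one _
  have h2 := totalDegree_X_le_one (k := k) (Sum.inl a : (Fin 4 → Fin n) ⊕ Fin m)
  simp only [Finset.card_univ, Fintype.card_fin] at h1
  refine (totalDegree_mul _ _).trans ?_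
  omega

/-- `deg G_n ≤ 21 (n+1)⁴`. [folklore] -/
theorem totalDegree_witness_le : (((∏ j : Fin 4, ((∏ pq ∈ conflictPairs n,
            (1 - X (Sum.inr (e (j, pq.1))) * X (Sum.inr (e (j, pq.2))))) *
          ∏ t : Fin n, ∑ i : Fin n, X (Sum.inr (e (j, (t, i)))))) *
        ((∏ j : Fin 4, rename (fun p => Sum.inr (e (j, p))) (detPoly (Fin n) k)) *
          ∏ i : Fin n, ∑ a : Fin 4 → Fin n,
            (∏ j : Fin 4, X (Sum.inr (e (j, (i, a j))))) * X (Sum.inl a)) :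
      MvPolynomial ((Fin 4 → Fin n) ⊕ Fin m) k)).totalDegree ≤ 21 * (n + 1) ^ 4 := by
  refine (totalDegree_mul _ _).trans ((add_le_add
    (totalDegree_prod_le_of_le _ _ _ fun j _ => (totalDegree_mul _ _).trans
      (add_le_add (totalDegree_alpha_le n k e j) (totalDegree_beta_le n k e j)))
    ((totalDegree_mul _ _).trans (add_le_add
      (totalDegree_prod_le_of_le _ _ _ fun j _ => totalDegree_sign_le n k e j)
      (totalDegree_cover_le n k e)))).trans ?_)
  simp only [Finset.card_univ, Fintype.card_fin]
  have e1 : n ^ 4 ≤ (n + 1) ^ 4 := pow_le_succ_pow n le_rfl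
  have e2 : n ≤ (n + 1) ^ 4 := (pow_one n).symm.le.trans (pow_le_succ_pow n (by norm_num))
  omega

/-- `L(α(Zʲ)) ≤ 4 n⁴` (`≤ n⁴` factors `1 + (-1)·(Z Z')` of cost `3`). [folklore] -/
theorem complexity_alpha_le (j : Fin 4) :
    complexity
      (∏ pq ∈ conflictPairs n, (1 - X (Sum.inr (e (j, pq.1))) * X (Sum.inr (e (j, pq.2)))) :
        MvPolynomial ((Fin 4 → Fin n) ⊕ Fin m) k) ≤ n ^ 4 * 3 + n ^ 4 := by
  refine (complexity_prod_le_of_le _ _ _ fun _ _ =>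
    complexity_one_sub_X_mul_X_le _ _).trans ?_
  have h := card_conflictPairs_le n
  gcongr

/-- `L(β(Zʲ)) ≤ n² + n` (inputs are free). [folklore] -/
theorem complexity_beta_le (j : Fin 4) :
    complexity (∏ t : Fin n, ∑ i : Fin n, X (Sum.inr (e (j, (t, i)))) :
      MvPolynomial ((Fin 4 → Fin n) ⊕ Fin m) k) ≤ n * (n * 0 + n) + n :=
  (complexity_prod_le_of_le _ _ _ fun _ _ => complexity_sum_le_of_le _ _ _ fun _ _ =>
    le_of_eq (complexity_X_holds (k := k) _)).trans (by simp)

/-- `L(det Zʲ) ≤ 8 (n+1)⁷` (Berkowitz, `complexity_detPoly_le`, after renaming). [folklore] -/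
theorem complexity_sign_le (j : Fin 4) :
    complexity (rename (fun p => Sum.inr (e (j, p))) (detPoly (Fin n) k) :
      MvPolynomial ((Fin 4 → Fin n) ⊕ Fin m) k) ≤ 8 * (n + 1) ^ 7 :=
  (complexity_rename_le_holds' _ _).trans (complexity_detPoly_le k n)

/-- `L(cover) ≤ n · 6 n⁴ + n` (`n⁴` summands of cost `≤ 5` per factor). [folklore] -/
theorem complexity_cover_le :
    complexity (∏ i : Fin n, ∑ a : Fin 4 → Fin n,
        (∏ j : Fin 4, X (Sum.inr (e (j, (i, a j))))) * X (Sum.inl a) :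
      MvPolynomial ((Fin 4 → Fin n) ⊕ Fin m) k) ≤ n * (n ^ 4 * 5 + n ^ 4) + n := by
  refine (complexity_prod_le_of_le _ _ (n ^ 4 * 5 + n ^ 4) fun i _ =>
    (complexity_sum_le_of_le _ _ 5 fun a _ => ?_).trans ?_).trans (by simp)
  · have h1 := complexity_prod_le_of_le (Finset.univ : Finset (Fin 4))
      (fun j => (X (Sum.inr (e (j, (i, a j)))) : MvPolynomial ((Fin 4 → Fin n) ⊕ Fin m) k)) 0
      fun _ _ => le_of_eq (complexity_X_holds (k := k) _)
    have h2 := complexity_X_holds (k := k) (Sum.inl a : (Fin 4 → Fin n) ⊕ Fin m)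
    have h3 := complexity_mul_le_holds
      (∏ j : Fin 4, (X (Sum.inr (e (j, (i, a j)))) : MvPolynomial ((Fin 4 → Fin n) ⊕ Fin m) k))
      (X (Sum.inl a))
    simp only [Finset.card_univ, Fintype.card_fin] at h1
    omega
  · simp only [Finset.card_univ, Fintype.card_fun, Fintype.card_fin]
    exact le_rfl

/-- `L(G_n) ≤ 83 (n+1)⁷`. [folklore] -/
theorem complexity_witness_le : complexity ((∏ j : Fin 4, ((∏ pq ∈ conflictPairs n,
            (1 - X (Sum.inr (e (j, pq.1))) * X (Sum.inr (e (j, pq.2))))) *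
          ∏ t : Fin n, ∑ i : Fin n, X (Sum.inr (e (j, (t, i)))))) *
        ((∏ j : Fin 4, rename (fun p => Sum.inr (e (j, p))) (detPoly (Fin n) k)) *
          ∏ i : Fin n, ∑ a : Fin 4 → Fin n,
            (∏ j : Fin 4, X (Sum.inr (e (j, (i, a j))))) * X (Sum.inl a)) :
      MvPolynomial ((Fin 4 → Fin n) ⊕ Fin m) k) ≤ 83 * (n + 1) ^ 7 := by
  have e1 : n ^ 4 ≤ (n + 1) ^ 7 := pow_le_succ_pow n (by norm_num)
  have e2 : n ^ 2 ≤ (n + 1) ^ 7 := pow_le_succ_pow n (by norm_num)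
  have e3 : n ^ 5 ≤ (n + 1) ^ 7 := pow_le_succ_pow n (by norm_num)
  have e4 : n ≤ (n + 1) ^ 7 := (pow_one n).symm.le.trans (pow_le_succ_pow n (by norm_num))
  have e5 : 1 ≤ (n + 1) ^ 7 := Nat.one_le_pow _ _ n.succ_pos
  have hAB : ∀ j ∈ (Finset.univ : Finset (Fin 4)), complexity
      (((∏ pq ∈ conflictPairs n, (1 - X (Sum.inr (e (j, pq.1))) * X (Sum.inr (e (j, pq.2))))) *
        ∏ t : Fin n, ∑ i : Fin n, X (Sum.inr (e (j, (t, i))))) :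
        MvPolynomial ((Fin 4 → Fin n) ⊕ Fin m) k) ≤ 7 * (n + 1) ^ 7 := by
    intro j _
    have h1 := complexity_alpha_le n k e j
    have h2 := complexity_beta_le n k e j
    have h22 : n * (n * 0 + n) + n ≤ 2 * (n + 1) ^ 7 := by nlinarith
    refine (complexity_mul_le_holds _ _).trans ?_
    omega
  have hC : n * (n ^ 4 * 5 + n ^ 4) + n ≤ 7 * (n + 1) ^ 7 := by nlinarith
  refine (complexity_mul_le_holds _ _).trans ?_
  refine (Nat.succ_le_succ (add_le_add (complexity_prod_le_of_le _ _ _ hAB)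
    ((complexity_mul_le_holds _ _).trans (Nat.succ_le_succ (add_le_add
      (complexity_prod_le_of_le _ _ _ fun j _ => complexity_sign_le n k e j)
      (complexity_cover_le n k e)))))).trans ?_
  simp only [Finset.card_univ, Fintype.card_fin]
  omega

/-- `deg HD_n ≤ n` (each term is `± ∏_{i < n} x_I`). [folklore] -/
theorem totalDegree_hyperdet_X_le :
    (hyperdet (fun I : Fin 4 → Fin n => (X I : MvPolynomial (Fin 4 → Fin n) k))).totalDegree ≤
      n := by
  unfold hyperdet
  dsimp only
  refine totalDegree_sum_le_of_le _ _ _ fun σ _ => (totalDegree_mul _ _).trans ?_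
  have h1 : (∏ j, (Equiv.Perm.sign (σ j) : MvPolynomial (Fin 4 → Fin n) k)).totalDegree ≤
      (Finset.univ : Finset (Fin 4)).card * 0 :=
    totalDegree_prod_le_of_le _ _ 0 fun _ _ => by
      rw [← map_intCast (C : k →+* MvPolynomial (Fin 4 → Fin n) k), totalDegree_C]
  have h2 : (∏ i, (X (fun j => σ j i) : MvPolynomial (Fin 4 → Fin n) k)).totalDegree ≤
      (Finset.univ : Finset (Fin n)).card * 1 :=
    totalDegree_prod_le_of_le _ _ 1 fun _ _ => totalDegree_X_le_one _
  simp only [Finset.card_univ, Fintype.card_fin, mul_zero, mul_one] at h1 h2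
  omega

/-- **`HD` is a p-family**: `n⁴` variables, degree `≤ n`. [folklore] -/
theorem isPFamily_hyperdet :
    IsPFamily (fun n =>
      hyperdet (fun I : Fin 4 → Fin n => (X I : MvPolynomial (Fin 4 → Fin n) k))) := by
  refine ⟨(IsPBounded.iff_exists_le_mul_succ_pow _).2 ⟨1, 4, fun n => ?_⟩,
    (IsPBounded.iff_exists_le_mul_succ_pow _).2 ⟨1, 1, fun n => ?_⟩⟩
  · simp only [Fintype.card_fun, Fintype.card_fin, one_mul]
    exact pow_le_succ_pow n le_rfl
  · dsimp only
    rw [pow_one, one_mul]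
    exact (totalDegree_hyperdet_X_le n k).trans (Nat.le_succ n)

/-- **The `VNP` witness for `HD_n`**, Boolean block `Fin (4 n²)` (enumerated by
`finProdFinEquiv`): degree `≤ 21 (n+1)⁴`, complexity `≤ 83 (n+1)⁷`, Boolean sum `HD_n`.
[folklore] -/
theorem exists_witness : ∃ g : MvPolynomial ((Fin 4 → Fin n) ⊕ Fin (4 * (n * n))) k,
    g.totalDegree ≤ 21 * (n + 1) ^ 4 ∧ complexity g ≤ 83 * (n + 1) ^ 7 ∧
      boolSum g = hyperdet (fun I : Fin 4 → Fin n => (X I : MvPolynomial (Fin 4 → Fin n) k)) :=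
  let e : Fin 4 × (Fin n × Fin n) ≃ Fin (4 * (n * n)) :=
    (Equiv.prodCongr (Equiv.refl (Fin 4)) finProdFinEquiv).trans finProdFinEquiv
  ⟨_, totalDegree_witness_le n k e, complexity_witness_le n k e, boolSum_witness n k e⟩

end Bounds

end HyperdetVNP

/-! ### `HD ∈ VNP` -/

open HyperdetVNP in
/-- **S2 — `HD ∈ VNP` over `ℂ`**: the generic four-dimensional hyperdeterminant family
`HD_n = ∑_{σ₀,…,σ₃ ∈ 𝔖_n} (∏_j sgn σ_j) ∏_i x_{σ₀ i, σ₁ i, σ₂ i, σ₃ i}` is p-definable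
(Bürgisser 2000, Def. 2.5): `n⁴` variables, degree `≤ n`, and `HD_n` is the Boolean sum over
`{0,1}^{4n²}` of a `VP` witness (four position matrices recognised by BCS's `α · β`, signs as
determinants of the position matrices; `HyperdetVNP.exists_witness`). [folklore] -/
theorem stub_isVNPFamily_hyperdet :
    IsVNPFamily
      (fun n => hyperdet (fun I : Fin 4 → Fin n => (X I : MvPolynomial (Fin 4 → Fin n) ℂ))) := by
  choose g hdeg hcomp hsum using fun n => exists_witness n ℂ
  refine ⟨isPFamily_hyperdet ℂ, fun n => 4 * (n * n), g,
    ⟨⟨(IsPBounded.iff_exists_le_mul_succ_pow _).2 ⟨5, 4, fun n => ?_⟩,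
      (IsPBounded.iff_exists_le_mul_succ_pow _).2 ⟨21, 4, hdeg⟩⟩,
      (IsPBounded.iff_exists_le_mul_succ_pow _).2 ⟨83, 7, hcomp⟩⟩, fun n => (hsum n).symm⟩
  simp only [Fintype.card_sum, Fintype.card_fun, Fintype.card_fin]
  have e1 : n ^ 4 ≤ (n + 1) ^ 4 := pow_le_succ_pow n le_rfl
  have e2 : n ^ 2 ≤ (n + 1) ^ 4 := pow_le_succ_pow n (by norm_num)
  nlinarith

end Summit.ValiantsHypothesis.ValiantsHypothesis.Theorems.DetQPDetqpThesis

end
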